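import Summits.CriticalPhenomena.PercolationContinuityZ3.Theorems.PercNearOneGluingNoHeavyLowerTailFrontierDecRowsClusterBHK3Key
import HarnessLib

/-!
# Conjecture G⁺ (`ClusterBHK3Pos`) from the KEY form at the edges INCIDENT TO `T` only

Support file (prover prim-ineq-prove-3 gen 11; `--supports stmt-CriticalPhenomena-4575`).  No sorries, no named facts, no definitions.

`…FrontierDecRowsClusterBHK3Key` (p245342) reduces `ClusterBHK3Pos` to the edge KEY form `K_e ≥ 0` at EVERY pair `e` (prim-bnk-1's schema
`EdgeInduction.sahiE3_nonneg_of_edgeKey`).  This file sharpens the reduction: it suffices to have `K_e ≥ 0` at the pairs `e` that MEET `T`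
(`∃ t ∈ T, t ∈ e`), for all terminal sets `S, T` and all cluster-monotone `A, B` — `clusterBHK3Pos_of_keyT`.

WHY THIS MATTERS (memo FINDING-PEEL-gen11.md §2).  For a `T`-edge `e = tv` and `T`-blind `A` (w.l.o.g.), `E₃` is QUADRATIC along `w e` and
the KEY form is explicit: `K_e = E₃(H; D[S|T∪v], Aᶜ, B′ᶜ) + μ(δ)μ(ε)[P(Aᶜ|δ) + P(Aᶜ|ε) − P(Aᶜ)]` on `H = G − e`
(`δ = {S↮T, S↔v}`, `ε` = "`v` pivotal for `B`"); at the last `T`-edge it is `μ(Aᶜ∩δ∩ε) + Cov(Aᶜ, D′∩B′ᶜ) ≥ 0` (Harris).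
KEY at pairs far from `T` is a genuinely cubic (and, by gen 10's numerics, harder) statement that is NOT needed.

PROOF.  Fix `n, S, A`.  Induction on `#fracEdges(w) + #(vertices outside T)` over all `(w, T, B)`:
* a fractional pair meeting `T` ⇒ the KEY step of the old schema (`sahiE3_ge_deletion_of_key`; `T, B` unchanged);
* no such pair but a weight-`1` pair `tv`, `t ∈ T`, `v ∉ T` ⇒ pass to `T′ = insert v T`: `D[S|T]` and `D[S|T′]` differ by a null set
  (`sahiE3_sepEv_insert_eq`) and `B` is cluster-monotone for `T′` too (`clusterMono_mono`);
* otherwise every pair leaving `T` has weight `0` and every pair meeting `T` is deterministic ⇒ `C_T` is a.s. constant ⇒ `Bᶜ` is a.s.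
  `∅` or `univ` ⇒ `E₃ ∈ {0, Cov(1_D, 1_{Aᶜ})} ≥ 0` (`sahiE3_nonneg_of_frozen`).
-/

noncomputable section

namespace Summit.CriticalPhenomena.PercolationContinuityZ3.Theorems.FrontierDecRows

open MeasureTheory
open Literature.Probability.Percolation Literature.Probability.LatticeModels
open Literature.Probability.Percolation.TwoSetExchange
open EdgeInduction TerminalEdgeInduction
open scoped Classical

variable {n : ℕ}

/-! ### Cluster-monotonicity is inherited by supersets of `T` -/

/-- If `B` is an increasing function of `C_T` then it is an increasing function of `C_{T'}` for every `T' ⊇ T`: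
an edge of `C_t(ω)` together with an open path to it lies in `C_{T'}(ω) ⊆ C_{T'}(ω') ⊆ ω'`. [this work] -/
theorem clusterMono_mono {V : Type*} {T T' : Set V} (hTT' : T ⊆ T') {B : Set (BondConfig V)}
    (hB : ∀ ⦃ω ω' : BondConfig V⦄, (⋃ t ∈ T, openEdgeCluster ω t) ⊆ (⋃ t ∈ T, openEdgeCluster ω' t) → ω ∈ B → ω' ∈ B) :
    ∀ ⦃ω ω' : BondConfig V⦄, (⋃ t ∈ T', openEdgeCluster ω t) ⊆ (⋃ t ∈ T', openEdgeCluster ω' t) → ω ∈ B → ω' ∈ B := by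
  intro ω ω' hsub hω
  refine hB (Set.iUnion₂_subset fun t ht => ?_) hω
  have h1 : openEdgeCluster ω t ⊆ ω' := fun e he => by
    obtain ⟨t', -, h⟩ := Set.mem_iUnion₂.1 (hsub (Set.mem_biUnion (hTT' ht) he))
    exact openEdgeCluster_subset ω' t' h
  exact (openEdgeCluster_subset_of_subset h1).trans (Set.subset_biUnion_of_mem ht)

/-! ### Null modifications of the separation event -/

/-- A weight-`1` pair is open almost surely. [folklore] -/
theorem real_setOf_notMem_eq_zero (w : Sym2 (Fin n) → unitInterval) {e : Sym2 (Fin n)} (he : w e = 1) :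
    (prodBernoulli w).real {ω : BondConfig (Fin n) | e ∉ ω} = 0 := by
  rw [prodBernoulli_real_setOf_notMem, he]; simp

/-- A weight-`0` pair is closed almost surely. [folklore] -/
theorem real_setOf_mem_eq_zero (w : Sym2 (Fin n) → unitInterval) {e : Sym2 (Fin n)} (he : w e = 0) :
    (prodBernoulli w).real {ω : BondConfig (Fin n) | e ∈ ω} = 0 := by
  rw [prodBernoulli_real_setOf_mem, he]; simp

/-- Intersections with two events that differ by a null set have the same measure. [folklore] -/
theorem real_inter_eq_of_subset_of_diff_null {μ : Measure (BondConfig (Fin n))} [IsFiniteMeasure μ] {D D' : Set (BondConfig (Fin n))}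
    (hsub : D' ⊆ D) (hnull : μ.real (D \ D') = 0) (X Y : Set (BondConfig (Fin n))) :
    μ.real (X ∩ D ∩ Y) = μ.real (X ∩ D' ∩ Y) := by
  apply le_antisymm
  · have hle : X ∩ D ∩ Y ⊆ (X ∩ D' ∩ Y) ∪ (D \ D') := by
      intro ω hω
      by_cases h : ω ∈ D'
      · exact Or.inl ⟨⟨hω.1.1, h⟩, hω.2⟩
      · exact Or.inr ⟨hω.1.2, h⟩
    calc μ.real (X ∩ D ∩ Y) ≤ μ.real ((X ∩ D' ∩ Y) ∪ (D \ D')) := measureReal_mono hle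
      _ ≤ μ.real (X ∩ D' ∩ Y) + μ.real (D \ D') := measureReal_union_le _ _
      _ = μ.real (X ∩ D' ∩ Y) := by rw [hnull, add_zero]
  · exact measureReal_mono fun ω hω => ⟨⟨hω.1.1, hsub hω.1.2⟩, hω.2⟩

/-- `E₃(D, Y, Z) = E₃(D', Y, Z)` if `D' ⊆ D` and `D ∖ D'` is null. [folklore] -/
theorem sahiE3_congr_of_diff_null {μ : Measure (BondConfig (Fin n))} [IsFiniteMeasure μ] {D D' : Set (BondConfig (Fin n))}
    (hsub : D' ⊆ D) (hnull : μ.real (D \ D') = 0) (Y Z : Set (BondConfig (Fin n))) :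
    sahiE3 μ D Y Z = sahiE3 μ D' Y Z := by
  have h := real_inter_eq_of_subset_of_diff_null hsub hnull
  have e1 : μ.real D = μ.real D' := by simpa using h Set.univ Set.univ
  have e2 : μ.real (D ∩ Y) = μ.real (D' ∩ Y) := by simpa using h Set.univ Y
  have e3 : μ.real (D ∩ Z) = μ.real (D' ∩ Z) := by simpa using h Set.univ Z
  have e4 : μ.real (D ∩ Y ∩ Z) = μ.real (D' ∩ Y ∩ Z) := by
    simpa [Set.inter_assoc] using h Set.univ (Y ∩ Z)
  simp only [sahiE3_def, e1, e2, e3, e4]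

/-- **Absorbing a weight-one neighbour**: if `t ∈ T`, `v ∉ T`… precisely if `w s(t,v) = 1` with `t ∈ T`, then `D[S|T]` and `D[S|insert v T]`
differ by the null set `{s(t,v) closed}`, so `E₃` is unchanged. [this work] -/
theorem sahiE3_sepEv_insert_eq (w : Sym2 (Fin n) → unitInterval) (S T : Set (Fin n)) {t v : Fin n} (ht : t ∈ T) (htv : t ≠ v)
    (hw : w s(t, v) = 1) (Y Z : Set (BondConfig (Fin n))) :
    sahiE3 (prodBernoulli w) {ω : BondConfig (Fin n) | ∀ s ∈ S, ∀ t ∈ T, ¬ (openGraph ω).Reachable s t} Y Z =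
      sahiE3 (prodBernoulli w) {ω : BondConfig (Fin n) | ∀ s ∈ S, ∀ t ∈ insert v T, ¬ (openGraph ω).Reachable s t} Y Z := by
  refine sahiE3_congr_of_diff_null (D' := {ω : BondConfig (Fin n) | ∀ s ∈ S, ∀ t ∈ insert v T, ¬ (openGraph ω).Reachable s t})
    (by intro ω hω s hs t' ht'; exact hω s hs t' (Set.mem_insert_of_mem v ht')) ?_ Y Z
  refine le_antisymm ((measureReal_mono ?_).trans (real_setOf_notMem_eq_zero w hw).le) measureReal_nonneg
  rintro ω ⟨hD, hD'⟩ hopen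
  apply hD'
  intro s hs t' ht'
  rcases Set.mem_insert_iff.1 ht' with rfl | ht'T
  · intro hsv
    exact hD s hs t ht (hsv.trans (SimpleGraph.Adj.reachable ((openGraph_adj ω _ t).2 ⟨by rwa [Sym2.eq_swap], htv.symm⟩)))
  · exact hD s hs t' ht'T

/-! ### The frozen case: every pair meeting `T` is deterministic and no weight-one pair leaves `T` -/

/-- In the frozen case `Bᶜ` is almost surely `∅` or `univ`, whence `E₃(D, Aᶜ, Bᶜ) ∈ {0, Cov(1_D,1_{Aᶜ})} ≥ 0`. [this work] -/
theorem sahiE3_nonneg_of_frozen (w : Sym2 (Fin n) → unitInterval) (S T : Set (Fin n)) {A B : Set (BondConfig (Fin n))}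
    (hA : ∀ ⦃ω ω' : BondConfig (Fin n)⦄, (⋃ s ∈ S, openEdgeCluster ω s) ⊆ (⋃ s ∈ S, openEdgeCluster ω' s) → ω ∈ A → ω' ∈ A)
    (hB : ∀ ⦃ω ω' : BondConfig (Fin n)⦄, (⋃ t ∈ T, openEdgeCluster ω t) ⊆ (⋃ t ∈ T, openEdgeCluster ω' t) → ω ∈ B → ω' ∈ B)
    (h01 : ∀ e : Sym2 (Fin n), (∃ t ∈ T, t ∈ e) → w e = 0 ∨ w e = 1)
    (h0 : ∀ t ∈ T, ∀ v ∉ T, w s(t, v) ≠ 1) :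
    0 ≤ sahiE3 (prodBernoulli w) {ω : BondConfig (Fin n) | ∀ s ∈ S, ∀ t ∈ T, ¬ (openGraph ω).Reachable s t} Aᶜ Bᶜ := by
  set μ := prodBernoulli w with hμ
  set D := {ω : BondConfig (Fin n) | ∀ s ∈ S, ∀ t ∈ T, ¬ (openGraph ω).Reachable s t} with hD
  -- the canonical configuration and the null set off which everything at `T` is frozen
  set ω₁ : BondConfig (Fin n) := {e | w e = 1} with hω₁
  set N : Set (BondConfig (Fin n)) := {ω | ∃ e : Sym2 (Fin n), (∃ t ∈ T, t ∈ e) ∧ ¬ (e ∈ ω ↔ e ∈ ω₁)} with hN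
  have hNnull : μ.real N = 0 := by
    have hNeq : N = ⋃ e : Sym2 (Fin n), {ω : BondConfig (Fin n) | (∃ t ∈ T, t ∈ e) ∧ ¬ (e ∈ ω ↔ e ∈ ω₁)} := by
      ext ω; simp only [hN, Set.mem_setOf_eq, Set.mem_iUnion]
    have hpiece : ∀ e : Sym2 (Fin n), μ.real {ω : BondConfig (Fin n) | (∃ t ∈ T, t ∈ e) ∧ ¬ (e ∈ ω ↔ e ∈ ω₁)} = 0 := by
      intro e
      refine le_antisymm ?_ measureReal_nonneg
      by_cases he : ∃ t ∈ T, t ∈ e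
      · rcases h01 e he with h0e | h1e
        · have hne : e ∉ ω₁ := by
            rw [hω₁]; simp only [Set.mem_setOf_eq, h0e]; exact zero_ne_one
          calc μ.real {ω : BondConfig (Fin n) | (∃ t ∈ T, t ∈ e) ∧ ¬ (e ∈ ω ↔ e ∈ ω₁)}
              ≤ μ.real {ω : BondConfig (Fin n) | e ∈ ω} := measureReal_mono fun ω hω => by
                  have h := hω.2; by_contra hc; exact h ⟨fun h' => absurd h' hc, fun h' => absurd h' hne⟩
            _ = 0 := real_setOf_mem_eq_zero w h0e
        · have hme : e ∈ ω₁ := by rw [hω₁]; exact h1e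
          calc μ.real {ω : BondConfig (Fin n) | (∃ t ∈ T, t ∈ e) ∧ ¬ (e ∈ ω ↔ e ∈ ω₁)}
              ≤ μ.real {ω : BondConfig (Fin n) | e ∉ ω} := measureReal_mono fun ω hω => by
                  have h := hω.2; intro hc; exact h ⟨fun _ => hme, fun _ => hc⟩
            _ = 0 := real_setOf_notMem_eq_zero w h1e
      · exact le_of_eq (by
          have : {ω : BondConfig (Fin n) | (∃ t ∈ T, t ∈ e) ∧ ¬ (e ∈ ω ↔ e ∈ ω₁)} = ∅ := by
            ext ω; simp only [Set.mem_setOf_eq, Set.mem_empty_iff_false, iff_false, not_and]; exact fun h => absurd h he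
          rw [this, measureReal_empty])
    refine le_antisymm ?_ measureReal_nonneg
    rw [hNeq]
    refine (measureReal_iUnion_fintype_le _).trans (le_of_eq ?_)
    exact Finset.sum_eq_zero fun e _ => hpiece e
  -- reachability from `T` in `ω₁` stays inside `T`
  have hstay : ∀ t ∈ T, ∀ x, (openGraph ω₁).Reachable t x → x ∈ T := by
    intro t ht x hr
    obtain ⟨p⟩ := hr
    suffices h : ∀ (u y : Fin n) (q : (openGraph ω₁).Walk u y), u ∈ T → y ∈ T from h t x p ht
    intro u y q
    induction q with
    | nil => exact id
    | @cons a b c hadj q ih =>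
      intro ha
      have hb : b ∈ T := by
        by_contra hb
        have h1 : w s(a, b) = 1 := ((openGraph_adj ω₁ a b).1 hadj).1
        exact h0 a ha b hb h1
      exact ih hb
  -- off `N`, the clusters of `T` are those of `ω₁`
  have hclust : ∀ ω ∉ N, ∀ t ∈ T, openEdgeCluster ω t = openEdgeCluster ω₁ t := by
    intro ω hω t ht
    refine BHK2006.openEdgeCluster_eq_of_agree (fun e he => ?_) rfl
    have hmeet : ∃ t' ∈ T, t' ∈ e := by
      obtain ⟨x, hx, hx'⟩ := he
      rcases hx' with hxt | ⟨e', he', hxe'⟩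
      · exact ⟨x, hxt ▸ ht, hx⟩
      · obtain ⟨-, -, hreach⟩ := (mem_openEdgeCluster_iff ω₁ t e').1 he'
        exact ⟨x, hstay t ht x (hreach x hxe'), hx⟩
    by_contra hne
    exact hω ⟨e, hmeet, fun h => hne h.symm⟩
  have hBconst : ∀ ω ∉ N, (ω ∈ B ↔ ω₁ ∈ B) := by
    intro ω hω
    have e1 : (⋃ t ∈ T, openEdgeCluster ω t) = ⋃ t ∈ T, openEdgeCluster ω₁ t :=
      Set.iUnion₂_congr fun t ht => hclust ω hω t ht
    exact ⟨fun h => hB e1.le h, fun h => hB e1.ge h⟩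
  -- hence `μ(X ∩ Bᶜ) = [ω₁ ∉ B] · μ(X)`
  have hmeas : ∀ X : Set (BondConfig (Fin n)), μ.real (X ∩ Bᶜ) = if ω₁ ∈ B then 0 else μ.real X := by
    intro X
    split_ifs with h1
    · refine le_antisymm ((measureReal_mono ?_).trans hNnull.le) measureReal_nonneg
      intro ω hω
      by_contra hωN
      exact hω.2 ((hBconst ω hωN).2 h1)
    · apply le_antisymm (measureReal_mono Set.inter_subset_left)
      have hle : X ⊆ (X ∩ Bᶜ) ∪ N := by
        intro ω hω
        by_cases hωN : ω ∈ N
        · exact Or.inr hωN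
        · exact Or.inl ⟨hω, fun hb => h1 ((hBconst ω hωN).1 hb)⟩
      calc μ.real X ≤ μ.real ((X ∩ Bᶜ) ∪ N) := measureReal_mono hle
        _ ≤ μ.real (X ∩ Bᶜ) + μ.real N := measureReal_union_le _ _
        _ = μ.real (X ∩ Bᶜ) := by rw [hNnull, add_zero]
  have hBc : μ.real Bᶜ = if ω₁ ∈ B then 0 else 1 := by
    have := hmeas Set.univ
    simp only [Set.univ_inter, probReal_univ] at this
    exact this
  -- Harris for the case `Bᶜ = univ` a.s.
  have hHarris : μ.real D * μ.real Aᶜ ≤ μ.real (D ∩ Aᶜ) :=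
    prodBernoulli_harris_lower w (ClusterMarkovE3.isLowerSet_sepEv S T) (isUpperSet_of_clusterMono S hA).compl
      MeasurableSet.of_discrete MeasurableSet.of_discrete
  rw [sahiE3_def, hmeas (D ∩ Aᶜ), hmeas Aᶜ, hmeas D, hBc]
  split_ifs with h1
  · simp
  · nlinarith [hHarris]

/-! ### The induction -/

/-- Absorbing a new vertex into `T` decreases the number of outside vertices. [folklore] -/
theorem ncard_compl_insert_lt {T : Set (Fin n)} {v : Fin n} (hv : v ∉ T) : (insert v T)ᶜ.ncard < Tᶜ.ncard := by
  refine Set.ncard_lt_ncard ⟨Set.compl_subset_compl.2 (Set.subset_insert v T), fun h => ?_⟩ (Set.toFinite _)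
  have : v ∈ (insert v T)ᶜ := h (Set.mem_compl hv)
  exact this (Set.mem_insert v T)

/-- **The induction**: for fixed `S, A`, positivity for all `(w, T, B)` from the KEY form at pairs meeting `T`. [this work] -/
theorem sahiE3_sep_compl_nonneg_of_keyT (S : Set (Fin n)) {A : Set (BondConfig (Fin n))}
    (hA : ∀ ⦃ω ω' : BondConfig (Fin n)⦄, (⋃ s ∈ S, openEdgeCluster ω s) ⊆ (⋃ s ∈ S, openEdgeCluster ω' s) → ω ∈ A → ω' ∈ A)
    (hK : ∀ (T : Set (Fin n)) (B : Set (BondConfig (Fin n))),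
      (∀ ⦃ω ω' : BondConfig (Fin n)⦄, (⋃ t ∈ T, openEdgeCluster ω t) ⊆ (⋃ t ∈ T, openEdgeCluster ω' t) → ω ∈ B → ω' ∈ B) →
      ∀ (w : Sym2 (Fin n) → unitInterval) (e : Sym2 (Fin n)), (∃ t ∈ T, t ∈ e) →
      0 ≤ sahiE3 (prodBernoulli (Function.update w e 0))
            {ω : BondConfig (Fin n) | ∀ s ∈ S, ∀ t ∈ T, ¬ (openGraph ω).Reachable s t} Aᶜ Bᶜ →
      0 ≤ sahiE3 (prodBernoulli (Function.update w e 1))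
            {ω : BondConfig (Fin n) | ∀ s ∈ S, ∀ t ∈ T, ¬ (openGraph ω).Reachable s t} Aᶜ Bᶜ →
      0 ≤ key (prodBernoulli (Function.update w e 0)) (prodBernoulli (Function.update w e 1))
            {ω : BondConfig (Fin n) | ∀ s ∈ S, ∀ t ∈ T, ¬ (openGraph ω).Reachable s t} Aᶜ Bᶜ) :
    ∀ (w : Sym2 (Fin n) → unitInterval) (T : Set (Fin n)) (B : Set (BondConfig (Fin n))),
      (∀ ⦃ω ω' : BondConfig (Fin n)⦄, (⋃ t ∈ T, openEdgeCluster ω t) ⊆ (⋃ t ∈ T, openEdgeCluster ω' t) → ω ∈ B → ω' ∈ B) →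
      0 ≤ sahiE3 (prodBernoulli w) {ω : BondConfig (Fin n) | ∀ s ∈ S, ∀ t ∈ T, ¬ (openGraph ω).Reachable s t} Aᶜ Bᶜ := by
  suffices H : ∀ (k : ℕ) (w : Sym2 (Fin n) → unitInterval) (T : Set (Fin n)) (B : Set (BondConfig (Fin n))),
      (fracEdges w).card + Tᶜ.ncard ≤ k →
      (∀ ⦃ω ω' : BondConfig (Fin n)⦄, (⋃ t ∈ T, openEdgeCluster ω t) ⊆ (⋃ t ∈ T, openEdgeCluster ω' t) → ω ∈ B → ω' ∈ B) →
      0 ≤ sahiE3 (prodBernoulli w) {ω : BondConfig (Fin n) | ∀ s ∈ S, ∀ t ∈ T, ¬ (openGraph ω).Reachable s t} Aᶜ Bᶜ from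
    fun w T B hB => H _ w T B le_rfl hB
  intro k
  induction k with
  | zero =>
      intro w T B hk hB
      have hw : ∀ e, w e = 0 ∨ w e = 1 := fun e =>
        eq_zero_or_one_of_not_mem_fracEdges (by
          intro he
          have : 0 < (fracEdges w).card := Finset.card_pos.2 ⟨e, he⟩
          omega)
      rw [sahiE3_eq_zero_of_zeroOne w hw]
  | succ k ih =>
      intro w T B hk hB
      by_cases hcase1 : ∃ e ∈ fracEdges w, ∃ t ∈ T, t ∈ e
      · -- KEY step at a fractional pair meeting `T`
        obtain ⟨e, he, hte⟩ := hcase1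
        have hcard0 : (fracEdges (Function.update w e 0)).card + Tᶜ.ncard ≤ k := by
          have h1 := Finset.card_le_card (fracEdges_update_subset w e 0 (Or.inl rfl))
          rw [Finset.card_erase_of_mem he] at h1
          have : 0 < (fracEdges w).card := Finset.card_pos.2 ⟨e, he⟩
          omega
        have hcard1 : (fracEdges (Function.update w e 1)).card + Tᶜ.ncard ≤ k := by
          have h1 := Finset.card_le_card (fracEdges_update_subset w e 1 (Or.inr rfl))
          rw [Finset.card_erase_of_mem he] at h1
          have : 0 < (fracEdges w).card := Finset.card_pos.2 ⟨e, he⟩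
          omega
        have i0 := ih _ T B hcard0 hB
        have i1 := ih _ T B hcard1 hB
        have hKe := hK T B hB w e hte i0 i1
        have hp1 : (w e : ℝ) ≤ 1 := (w e).2.2
        have hq : (0 : ℝ) ≤ 1 - w e := sub_nonneg.2 hp1
        exact le_trans (mul_nonneg hq i0)
          (sahiE3_ge_deletion_of_key w e (ClusterMarkovE3.isLowerSet_sepEv S T) (isLowerSet_compl_of_clusterMono S hA)
            (isLowerSet_compl_of_clusterMono T hB) hKe i1)
      · push Not at hcase1
        by_cases hcase2 : ∃ t ∈ T, ∃ v ∉ T, w s(t, v) = 1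
        · -- absorb a weight-one neighbour into `T`
          obtain ⟨t, ht, v, hv, hw1⟩ := hcase2
          have htv : t ≠ v := fun h => hv (h ▸ ht)
          rw [sahiE3_sepEv_insert_eq w S T ht htv hw1]
          have hB' := clusterMono_mono (Set.subset_insert v T) hB
          refine ih w (insert v T) B ?_ hB'
          have hlt := ncard_compl_insert_lt (T := T) hv
          omega
        · -- frozen case
          push Not at hcase2
          refine sahiE3_nonneg_of_frozen w S T hA hB (fun e hte => ?_) hcase2
          exact eq_zero_or_one_of_not_mem_fracEdges fun he => by
            obtain ⟨t, ht, hte'⟩ := hte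
            exact hcase1 e he t ht hte'

/-- **G⁺ from the KEY form at the pairs meeting `T`.**  If for all `n`, all terminal sets `S, T`, all cluster-monotone `A` (w.r.t. `C_S`) and
`B` (w.r.t. `C_T`), every weight function `w` and every pair `e` with `∃ t ∈ T, t ∈ e`, the KEY form of `E₃({S ↮ T}, Aᶜ, Bᶜ)` along `e` is
nonnegative whenever `E₃ ≥ 0` under both `w[e↦0]` and `w[e↦1]`, then `ClusterBHK3Pos` holds.  (Sharpens `clusterBHK3Pos_of_key`, which asks for
the KEY form at every pair.) [this work] -/
theorem clusterBHK3Pos_of_keyT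
    (hK : ∀ (n : ℕ) (S T : Set (Fin n)) (A B : Set (BondConfig (Fin n))),
      (∀ ⦃ω ω' : BondConfig (Fin n)⦄, (⋃ s ∈ S, openEdgeCluster ω s) ⊆ (⋃ s ∈ S, openEdgeCluster ω' s) → ω ∈ A → ω' ∈ A) →
      (∀ ⦃ω ω' : BondConfig (Fin n)⦄, (⋃ t ∈ T, openEdgeCluster ω t) ⊆ (⋃ t ∈ T, openEdgeCluster ω' t) → ω ∈ B → ω' ∈ B) →
      ∀ (w : Sym2 (Fin n) → unitInterval) (e : Sym2 (Fin n)), (∃ t ∈ T, t ∈ e) →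
      0 ≤ sahiE3 (prodBernoulli (Function.update w e 0))
            {ω : BondConfig (Fin n) | ∀ s ∈ S, ∀ t ∈ T, ¬ (openGraph ω).Reachable s t} Aᶜ Bᶜ →
      0 ≤ sahiE3 (prodBernoulli (Function.update w e 1))
            {ω : BondConfig (Fin n) | ∀ s ∈ S, ∀ t ∈ T, ¬ (openGraph ω).Reachable s t} Aᶜ Bᶜ →
      0 ≤ key (prodBernoulli (Function.update w e 0)) (prodBernoulli (Function.update w e 1))
            {ω : BondConfig (Fin n) | ∀ s ∈ S, ∀ t ∈ T, ¬ (openGraph ω).Reachable s t} Aᶜ Bᶜ) :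
    ClusterBHK3Pos := by
  intro n w S T A B hA hB
  exact sahiE3_sep_compl_nonneg_of_keyT S hA (fun T' B' hB' w' e he i0 i1 => hK n S T' A B' hA hB' w' e he i0 i1) w T B hB

end Summit.CriticalPhenomena.PercolationContinuityZ3.Theorems.FrontierDecRows

end
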